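import Literature.Analysis.Quadrature.LatticeRules

/-!
# Good lattice points of Korobov form exist for prime moduli (Niederreiter 1992, Theorem 5.18)

For an integer `N ≥ 2` let `C(N) = (-N/2, N/2] ∩ ℤ`, `C*(N) = C(N) ∖ {0}`, `C_s(N) = C(N)^s`,
`C_s*(N) = C_s(N) ∖ {0}` [cite: Niederreiter1992, §3.2]; `r(h) = max(1, |h|)` for `h ∈ ℤ` and
`r(𝐡) = ∏ᵢ r(hᵢ)` (§5.1); and, for a lattice point `g ∈ ℤ^s` and a modulus `N`, the **figure of
merit** `R(g, N) = Σ r(𝐡)⁻¹`, the sum running over all `𝐡 ∈ C_s*(N)` with `𝐡 · g ≡ 0 (mod N)`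
[cite: Niederreiter1992, Def. 5.4] — i.e. over the nonzero points of `C_s(N)` lying in the dual lattice
`L⊥` of `Literature.Analysis.Quadrature.LatticeRules` (`dualLattice N g`).  `R(g, N)` controls both the
discrepancy of the lattice point set (Thm. 5.6) and `P_α(g, N)` (Thm. 5.5); a **good lattice point** is
one with small `R(g, N)`.

We formalise, with complete proofs, the existence theorem for good lattice points of **Korobov form**
`(1, g, g², …, g^{s-1})` (Korobov 1959):

* `korobovMean_lt` = **Theorem 5.18** [cite: Niederreiter1992, Thm. 5.18]: for any integer `s ≥ 2`
  and any prime `N`, `m_s(N) := (1/N) Σ_{g=0}^{N-1} R((1, g, …, g^{s-1}), N) < ((s-1)/N) (2 log N + 1)^s`;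
* `exists_korobovPoint_figureOfMerit_lt` = its stated consequence (loc. cit., the paragraph after the
  proof): there is a `g`, `0 ≤ g ≤ N - 1`, with `R((1, g, …, g^{s-1}), N) < ((s-1)/N) (2 log N + 1)^s`.

The proof is Niederreiter's: interchange the summations; for `𝐡 ∈ C_s*(N)` the congruence
`Σᵢ hᵢ g^{i-1} ≡ 0 (mod N)` is a nonzero polynomial congruence of degree `≤ s - 1` over the field
`ℤ/Nℤ` (nonzero because `0 < |hᵢ| ≤ N/2 < N` for some `i`), so it has at most `s - 1` solutions
`g` (Mathlib's `Polynomial.card_le_degree_of_subset_roots` applied to `Polynomial.ofFn`); then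
`Σ_{𝐡 ∈ C_s*(N)} r(𝐡)⁻¹ < Σ_{𝐡 ∈ C_s(N)} r(𝐡)⁻¹ = (1 + L(N))^s` with
`L(N) = Σ_{h ∈ C*(N)} |h|⁻¹` (the notation of the proof of Thm. 5.10, before (5.15)), and finally the
elementary estimate `L(N) < 2 log N` (`harmL_lt`, the last inequality of the printed proof; cf. the
asymptotics (5.18) of `L(N)` quoted there from [226]).  We prove `L(N) < 2 log N` for every integer
`N ≥ 2` from `L(2k+2) = L(2k+1) + 1/(k+1)`, `L(2k+3) = L(2k+2) + 1/(k+1)` and the inequality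
`2/(2a+1) < log(1 + 1/a)` (`a > 0`), the first term of Mathlib's positive series
`Real.hasSum_log_one_add_inv`.

Design: `C(N)` is the `Finset ℤ` cut out of `[-N, N]` by `-N < 2h ≤ N` (division-free form of
`(-N/2, N/2]`); boxes, weights and `R(g, N)` are stated for an arbitrary finite index type `d` (as in
`LatticeRules`), Korobov points for `Fin s` with exponents `0, …, s-1`.  Deliberately NOT here: the
general-modulus averages `M_s(N)` (Thms. 5.8–5.10, 5.13) and the `P_α` / `ρ(g, N)` companions
(Thms. 5.19–5.22), whose proofs need the asymptotic expansion (5.18) of `L(N)` and Möbius inversion.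

## References

* H. Niederreiter, *Random Number Generation and Quasi-Monte Carlo Methods*, CBMS-NSF 63, SIAM 1992:
  §3.2 (the sets `C(N)`), §5.1 (`r(h)`), Definition 5.4 (`R(g, N)`), Theorem 5.18 with its proof and
  the remark following it. [cite: Niederreiter1992, Thm. 5.18]
* N. M. Korobov, *The approximate computation of multiple integrals*, Dokl. Akad. Nauk SSSR 124 (1959)
  1207–1210 (the form `(1, g, …, g^{s-1})`; attribution as given by Niederreiter, ref. [159], not
  consulted directly).

AI-produced formalisation (H21 engines group, seat eng-quad-1, 2026-08-20); no facts, no axioms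
beyond Mathlib's, no `sorry`.
-/

open Finset Real

noncomputable section

namespace Literature.Analysis.Quadrature

variable {d : Type*} [Fintype d] [DecidableEq d]

/-! ### The sets `C(N)`, `C_d(N)`, the weight `r(𝐡)` and the figure of merit `R(g, N)` -/

/-- `C(N) = (-N/2, N/2] ∩ ℤ`, written division-free as `{h ∈ ℤ : -N < 2h ≤ N}` (a complete residue
system modulo `N`, centred at `0`). [cite: Niederreiter1992, §3.2] -/
def centeredResidues (N : ℕ) : Finset ℤ :=
  (Finset.Icc (-(N : ℤ)) N).filter fun h => -(N : ℤ) < 2 * h ∧ 2 * h ≤ N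

/-- `h ∈ C(N) ↔ -N < 2h ≤ N`. [cite: Niederreiter1992, §3.2] -/
theorem mem_centeredResidues {N : ℕ} {h : ℤ} :
    h ∈ centeredResidues N ↔ -(N : ℤ) < 2 * h ∧ 2 * h ≤ N := by
  simp only [centeredResidues, Finset.mem_filter, Finset.mem_Icc]
  omega

/-- `C_d(N) = C(N)^d ⊆ ℤ^d`, the box of lattice points with all coordinates in `C(N)`.
[cite: Niederreiter1992, §3.2] -/
def centeredBox (d : Type*) [Fintype d] [DecidableEq d] (N : ℕ) : Finset (d → ℤ) :=
  Fintype.piFinset fun _ : d => centeredResidues N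

omit [DecidableEq d] in
/-- `𝐡 ∈ C_d(N) ↔ hⱼ ∈ C(N)` for all `j`. [cite: Niederreiter1992, §3.2] -/
theorem mem_centeredBox [DecidableEq d] {N : ℕ} {h : d → ℤ} :
    h ∈ centeredBox d N ↔ ∀ j, h j ∈ centeredResidues N :=
  Fintype.mem_piFinset

/-- The weight `r(𝐡) = ∏ⱼ r(hⱼ)` with `r(h) = max(1, |h|)`, as a real number.
[cite: Niederreiter1992, §5.1] -/
def rWeight (h : d → ℤ) : ℝ :=
  ∏ j, max 1 |(h j : ℝ)|

omit [DecidableEq d] in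
/-- `r(𝐡) > 0`. [cite: Niederreiter1992, §5.1] -/
theorem rWeight_pos (h : d → ℤ) : 0 < rWeight h :=
  Finset.prod_pos fun _ _ => lt_max_of_lt_left one_pos

/-- The **figure of merit** `R(g, N) = Σ r(𝐡)⁻¹` over the `𝐡 ∈ C_d*(N)` with `𝐡 · g ≡ 0 (mod N)`,
i.e. over the nonzero points of `C_d(N)` in the dual lattice `L⊥ = dualLattice N g`.
[cite: Niederreiter1992, Def. 5.4] -/
def figureOfMerit (g : d → ℤ) (N : ℕ) : ℝ :=
  ∑ h ∈ (centeredBox d N).filter (fun h => h ≠ 0 ∧ h ∈ dualLattice N g), (rWeight h)⁻¹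

/-- `L(N) = Σ_{h ∈ C*(N)} r(h)⁻¹ = Σ_{h ∈ C*(N)} |h|⁻¹` (notation of the proof of Theorem 5.10,
the display before (5.15)). [cite: Niederreiter1992, Thm. 5.10] -/
def harmL (N : ℕ) : ℝ :=
  ∑ h ∈ (centeredResidues N).filter (· ≠ 0), |(h : ℝ)|⁻¹

/-- The lattice point of **Korobov form** `(1, g, g², …, g^{s-1}) ∈ ℤ^s` (coordinate `i ↦ g^i`,
`i = 0, …, s-1`). [cite: Niederreiter1992, Thm. 5.18] -/
def korobovPoint (s : ℕ) (g : ℤ) : Fin s → ℤ := fun i => g ^ (i : ℕ)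

/-- `m_s(N) = (1/N) Σ_{g=0}^{N-1} R((1, g, g², …, g^{s-1}), N)`, the average figure of merit of the
Korobov-form lattice points modulo `N`. [cite: Niederreiter1992, Thm. 5.18] -/
def korobovMean (s N : ℕ) : ℝ :=
  (N : ℝ)⁻¹ * ∑ g ∈ Finset.range N, figureOfMerit (korobovPoint s ((g : ℕ) : ℤ)) N

/-! ### The elementary estimate `L(N) < 2 log N` (`N ≥ 2`) -/

/-- `2/(2a+1) < log(1 + 1/a)` for `a > 0`: the first term of the series
`log(1 + a⁻¹) = 2 Σ_k (2k+1)⁻¹ (2a+1)^{-(2k+1)}`, whose terms are positive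
(`Real.hasSum_log_one_add_inv`). [folklore] -/
private theorem two_div_lt_log_one_add_inv {a : ℝ} (ha : 0 < a) :
    2 / (2 * a + 1) < Real.log (1 + a⁻¹) := by
  have hs := Real.hasSum_log_one_add_inv ha
  have h2 := sum_le_hasSum (Finset.range 2) (fun j _ => by positivity) hs
  rw [Finset.sum_range_succ, Finset.sum_range_succ, Finset.sum_range_zero] at h2
  have e : (2 : ℝ) * (1 / (2 * ((0 : ℕ) : ℝ) + 1)) * (1 / (2 * a + 1)) ^ (2 * 0 + 1)
      = 2 / (2 * a + 1) := by
    simp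
    ring
  have hpos : (0 : ℝ) < 2 * (1 / (2 * ((1 : ℕ) : ℝ) + 1)) * (1 / (2 * a + 1)) ^ (2 * 1 + 1) := by
    positivity
  rw [e] at h2
  linarith

/-- `C*(1) = ∅`. [folklore] -/
private theorem centeredResidues_one_filter_ne_zero :
    (centeredResidues 1).filter (· ≠ 0) = ∅ := by
  ext h
  simp only [Finset.mem_filter, mem_centeredResidues, Finset.notMem_empty, iff_false, not_and,
    Nat.cast_one]
  omega

/-- `C*(2k+2) = C*(2k+1) ∪ {k+1}`. [folklore] -/
private theorem centeredResidues_even_filter_ne_zero (k : ℕ) :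
    (centeredResidues (2 * k + 2)).filter (· ≠ 0)
      = insert ((k : ℤ) + 1) ((centeredResidues (2 * k + 1)).filter (· ≠ 0)) := by
  ext h
  simp only [Finset.mem_filter, Finset.mem_insert, mem_centeredResidues]
  push_cast
  omega

/-- `C*(2k+3) = C*(2k+2) ∪ {-(k+1)}`. [folklore] -/
private theorem centeredResidues_odd_filter_ne_zero (k : ℕ) :
    (centeredResidues (2 * k + 3)).filter (· ≠ 0)
      = insert (-((k : ℤ) + 1)) ((centeredResidues (2 * k + 2)).filter (· ≠ 0)) := by
  ext h
  simp only [Finset.mem_filter, Finset.mem_insert, mem_centeredResidues]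
  push_cast
  omega

/-- `L(1) = 0`. [folklore] -/
private theorem harmL_one : harmL 1 = 0 := by
  rw [harmL, centeredResidues_one_filter_ne_zero, Finset.sum_empty]

/-- `L(2k+2) = 1/(k+1) + L(2k+1)`. [folklore] -/
private theorem harmL_even (k : ℕ) :
    harmL (2 * k + 2) = ((k : ℝ) + 1)⁻¹ + harmL (2 * k + 1) := by
  unfold harmL
  rw [centeredResidues_even_filter_ne_zero, Finset.sum_insert]
  · push_cast
    rw [abs_of_pos (by positivity)]
  · simp only [Finset.mem_filter, mem_centeredResidues]
    push_cast
    omega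

/-- `L(2k+3) = 1/(k+1) + L(2k+2)`. [folklore] -/
private theorem harmL_odd (k : ℕ) :
    harmL (2 * k + 3) = ((k : ℝ) + 1)⁻¹ + harmL (2 * k + 2) := by
  unfold harmL
  rw [centeredResidues_odd_filter_ne_zero, Finset.sum_insert]
  · push_cast
    rw [abs_neg, abs_of_pos (by positivity)]
  · simp only [Finset.mem_filter, mem_centeredResidues]
    push_cast
    omega

/-- The odd step: `1/(k+1) < log(2k+3) - log(2k+1)`. [folklore] -/
private theorem inv_lt_log_sub_log_odd (k : ℕ) :
    ((k : ℝ) + 1)⁻¹ < Real.log (2 * k + 3) - Real.log (2 * k + 1) := by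
  have ha : (0 : ℝ) < (2 * k + 1) / 2 := by positivity
  have h := two_div_lt_log_one_add_inv ha
  have e2 : (1 : ℝ) + ((2 * (k : ℝ) + 1) / 2)⁻¹ = (2 * k + 3) / (2 * k + 1) := by
    field_simp
    ring
  have e3 : (2 : ℝ) / (2 * ((2 * (k : ℝ) + 1) / 2) + 1) = ((k : ℝ) + 1)⁻¹ := by
    field_simp
    ring
  rw [e2, Real.log_div (by positivity) (by positivity), e3] at h
  exact h

/-- The even step: `1/(k+1) < 2 (log(2k+2) - log(2k+1))`. [folklore] -/
private theorem inv_lt_two_mul_log_sub_log_even (k : ℕ) :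
    ((k : ℝ) + 1)⁻¹ < 2 * (Real.log (2 * k + 2) - Real.log (2 * k + 1)) := by
  have ha : (0 : ℝ) < 2 * k + 1 := by positivity
  have h := two_div_lt_log_one_add_inv ha
  have e2 : (1 : ℝ) + (2 * (k : ℝ) + 1)⁻¹ = (2 * k + 2) / (2 * k + 1) := by
    field_simp
    ring
  rw [e2, Real.log_div (by positivity) (by positivity)] at h
  have e3 : ((k : ℝ) + 1)⁻¹ ≤ 2 * (2 / (2 * (2 * (k : ℝ) + 1) + 1)) := by
    rw [show (2 : ℝ) * (2 / (2 * (2 * (k : ℝ) + 1) + 1)) = 4 / (4 * k + 3) by ring, inv_eq_one_div,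
      div_le_div_iff₀ (by positivity) (by positivity)]
    linarith
  linarith

/-- Odd moduli: `L(2k+1) ≤ 2 log(2k+1)` (in fact `L(2k+1) = 2 H_k`, with equality only at
`k = 0`). [folklore] -/
private theorem harmL_two_mul_add_one_le (k : ℕ) :
    harmL (2 * k + 1) ≤ 2 * Real.log (2 * k + 1) := by
  induction k with
  | zero => simp [harmL_one]
  | succ k ih =>
    have e1 : 2 * (k + 1) + 1 = 2 * k + 3 := by ring
    rw [e1, harmL_odd, harmL_even]
    have key := inv_lt_log_sub_log_odd k
    push_cast
    have e4 : (2 : ℝ) * ((k : ℝ) + 1) + 1 = 2 * k + 3 := by ring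
    rw [e4]
    linarith

/-- Odd moduli `≥ 3`: `L(2k+3) < 2 log(2k+3)`. [folklore] -/
private theorem harmL_two_mul_add_three_lt (k : ℕ) :
    harmL (2 * k + 3) < 2 * Real.log (2 * k + 3) := by
  rw [harmL_odd, harmL_even]
  have h1 := harmL_two_mul_add_one_le k
  have key := inv_lt_log_sub_log_odd k
  linarith

/-- Even moduli: `L(2k+2) < 2 log(2k+2)`. [folklore] -/
private theorem harmL_two_mul_add_two_lt (k : ℕ) :
    harmL (2 * k + 2) < 2 * Real.log (2 * k + 2) := by
  rw [harmL_even]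
  have h1 := harmL_two_mul_add_one_le k
  have key := inv_lt_two_mul_log_sub_log_even k
  linarith

/-- **`L(N) < 2 log N`** for every integer `N ≥ 2`, i.e. `Σ_{h ∈ C*(N)} |h|⁻¹ + 1 < 2 log N + 1` —
the last inequality in the proof of Theorem 5.18 (there for prime `N`; cf. the asymptotics (5.18)
of `L(N)` quoted from [226]).  Proved here from `L(2k+2) = L(2k+1) + 1/(k+1)`,
`L(2k+3) = L(2k+2) + 1/(k+1)` and `2/(2a+1) < log(1 + 1/a)`. [cite: Niederreiter1992, Thm. 5.18] -/
theorem harmL_lt (N : ℕ) (hN : 2 ≤ N) : harmL N < 2 * Real.log N := by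
  obtain ⟨k, rfl | rfl⟩ := Nat.even_or_odd' N
  · obtain ⟨j, rfl⟩ : ∃ j, k = j + 1 := ⟨k - 1, by omega⟩
    have h := harmL_two_mul_add_two_lt j
    have e1 : 2 * (j + 1) = 2 * j + 2 := by ring
    have e2 : ((2 * (j + 1) : ℕ) : ℝ) = 2 * (j : ℝ) + 2 := by push_cast; ring
    rw [e2, e1]
    exact h
  · obtain ⟨j, rfl⟩ : ∃ j, k = j + 1 := ⟨k - 1, by omega⟩
    have h := harmL_two_mul_add_three_lt j
    have e1 : 2 * (j + 1) + 1 = 2 * j + 3 := by ring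
    have e2 : ((2 * (j + 1) + 1 : ℕ) : ℝ) = 2 * (j : ℝ) + 3 := by push_cast; ring
    rw [e2, e1]
    exact h

/-- `L(N) ≥ 0`. [folklore] -/
private theorem harmL_nonneg (N : ℕ) : 0 ≤ harmL N :=
  Finset.sum_nonneg fun _ _ => inv_nonneg.2 (abs_nonneg _)

/-! ### `Σ_{𝐡 ∈ C_d(N)} r(𝐡)⁻¹ = (1 + L(N))^d` -/

/-- `Σ_{h ∈ C(N)} r(h)⁻¹ = 1 + L(N)` for `N ≥ 1` (the term `h = 0` contributes `r(0)⁻¹ = 1`).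
[cite: Niederreiter1992, Thm. 5.18] -/
theorem sum_centeredResidues_inv_max_eq (N : ℕ) (hN : 1 ≤ N) :
    ∑ h ∈ centeredResidues N, (max 1 |(h : ℝ)|)⁻¹ = 1 + harmL N := by
  have h0 : (0 : ℤ) ∈ centeredResidues N := by
    rw [mem_centeredResidues]
    omega
  rw [← Finset.add_sum_erase _ _ h0, ← Finset.filter_ne']
  have e0 : (max 1 |((0 : ℤ) : ℝ)|)⁻¹ = 1 := by simp
  rw [e0, harmL]
  congr 1
  refine Finset.sum_congr rfl fun h hh => ?_
  have hne : h ≠ 0 := (Finset.mem_filter.1 hh).2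
  have h1 : (1 : ℝ) ≤ |(h : ℝ)| := by exact_mod_cast Int.one_le_abs hne
  rw [max_eq_right h1]

omit [DecidableEq d] in
/-- `Σ_{𝐡 ∈ C_d(N)} r(𝐡)⁻¹ = (Σ_{h ∈ C(N)} r(h)⁻¹)^{|d|} = (1 + L(N))^{|d|}` for `N ≥ 1`.
[cite: Niederreiter1992, Thm. 5.18] -/
theorem sum_centeredBox_inv_rWeight_eq [DecidableEq d] (N : ℕ) (hN : 1 ≤ N) :
    ∑ h ∈ centeredBox d N, (rWeight h)⁻¹ = (1 + harmL N) ^ Fintype.card d := by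
  rw [← sum_centeredResidues_inv_max_eq N hN, ← Finset.card_univ, ← Finset.prod_const,
    Finset.prod_univ_sum]
  refine Finset.sum_congr rfl fun h _ => ?_
  rw [rWeight, ← Finset.prod_inv_distrib]

/-! ### Theorem 5.18 -/

/-- The counting step of the proof of Theorem 5.18: for a prime `N` and `𝐡 ∈ C_s*(N)`, the number
`a(𝐡)` of `g ∈ {0, …, N-1}` with `𝐡 · (1, g, …, g^{s-1}) ≡ 0 (mod N)` is at most `s - 1`, because
`Σᵢ hᵢ g^{i-1} ≡ 0 (mod N)` is a nonzero polynomial congruence of degree `≤ s - 1` over the field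
`ℤ/Nℤ`. [cite: Niederreiter1992, Thm. 5.18] -/
theorem card_filter_mem_dualLattice_korobovPoint_le {s N : ℕ} (hs : 1 ≤ s) (hN : N.Prime)
    {h : Fin s → ℤ} (hC : h ∈ centeredBox (Fin s) N) (h0 : h ≠ 0) :
    #{g ∈ Finset.range N | h ∈ dualLattice N (korobovPoint s ((g : ℕ) : ℤ))} ≤ s - 1 := by
  classical
  haveI : Fact N.Prime := ⟨hN⟩
  set v : Fin s → ZMod N := fun i => (h i : ZMod N) with hv
  -- the polynomial `Σᵢ hᵢ X^i` over `ℤ/Nℤ` is nonzero of degree `≤ s - 1`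
  have hv0 : v ≠ 0 := by
    obtain ⟨i, hi⟩ := Function.ne_iff.1 h0
    intro hz
    have hzi : (h i : ZMod N) = 0 := by simpa [hv] using congr_fun hz i
    rw [ZMod.intCast_zmod_eq_zero_iff_dvd] at hzi
    have hCi := (mem_centeredBox.1 hC) i
    rw [mem_centeredResidues] at hCi
    have habs : |h i| < N := by
      rw [abs_lt]
      omega
    exact hi (Int.eq_zero_of_abs_lt_dvd hzi habs)
  have hp0 : Polynomial.ofFn s v ≠ 0 := by
    intro hz
    apply hv0
    apply Polynomial.injective_ofFn s
    rw [hz, Polynomial.ofFn_zero]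
  have hdeg : (Polynomial.ofFn s v).natDegree ≤ s - 1 :=
    Nat.le_sub_one_of_lt (Polynomial.ofFn_natDegree_lt hs v)
  -- `g ↦ g mod N` is injective on `{0, …, N-1}` and maps the solutions into the roots
  have hinj : Set.InjOn (fun g : ℕ => (g : ZMod N))
      ↑({g ∈ Finset.range N | h ∈ dualLattice N (korobovPoint s ((g : ℕ) : ℤ))}) := by
    intro a ha b hb hab
    have ha' : a < N := Finset.mem_range.1 (Finset.mem_filter.1 (Finset.mem_coe.1 ha)).1
    have hb' : b < N := Finset.mem_range.1 (Finset.mem_filter.1 (Finset.mem_coe.1 hb)).1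
    have hab' := (ZMod.natCast_eq_natCast_iff' a b N).1 hab
    rwa [Nat.mod_eq_of_lt ha', Nat.mod_eq_of_lt hb'] at hab'
  rw [← Finset.card_image_of_injOn hinj]
  refine le_trans (Polynomial.card_le_degree_of_subset_roots fun x hx => ?_) hdeg
  rw [Finset.mem_val, Finset.mem_image] at hx
  obtain ⟨g, hg, rfl⟩ := hx
  have hmem := (Finset.mem_filter.1 hg).2
  rw [mem_dualLattice_iff_cast_eq_zero] at hmem
  rw [Polynomial.mem_roots hp0, Polynomial.IsRoot.def, Polynomial.ofFn_eq_sum_monomial,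
    Polynomial.eval_finsetSum]
  simp only [Polynomial.eval_monomial]
  simpa [korobovPoint, hv] using hmem

/-- `R(g, N)` as a sum over `C_d*(N)` of an indicator of the dual lattice.
[folklore] -/
private theorem figureOfMerit_eq_sum_ite (g : d → ℤ) (N : ℕ) :
    figureOfMerit g N = ∑ h ∈ (centeredBox d N).filter (· ≠ 0),
      if h ∈ dualLattice N g then (rWeight h)⁻¹ else 0 := by
  rw [figureOfMerit, Finset.sum_filter, Finset.sum_filter]
  refine Finset.sum_congr rfl fun h _ => ?_
  rw [ite_and]

/-- The interchange-and-count step of the proof of Theorem 5.18: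
`Σ_{g=0}^{N-1} R((1, g, …, g^{s-1}), N) = Σ_{𝐡 ∈ C_s*(N)} a(𝐡) r(𝐡)⁻¹ ≤ (s-1) Σ_{𝐡 ∈ C_s*(N)} r(𝐡)⁻¹`
for a prime `N`. [cite: Niederreiter1992, Thm. 5.18] -/
theorem sum_figureOfMerit_korobovPoint_le {s N : ℕ} (hs : 1 ≤ s) (hN : N.Prime) :
    ∑ g ∈ Finset.range N, figureOfMerit (korobovPoint s ((g : ℕ) : ℤ)) N
      ≤ ((s - 1 : ℕ) : ℝ) * ∑ h ∈ (centeredBox (Fin s) N).filter (· ≠ 0), (rWeight h)⁻¹ := by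
  classical
  have key : ∀ h ∈ (centeredBox (Fin s) N).filter (· ≠ 0),
      (∑ g ∈ Finset.range N, if h ∈ dualLattice N (korobovPoint s ((g : ℕ) : ℤ)) then (rWeight h)⁻¹ else 0)
        ≤ ((s - 1 : ℕ) : ℝ) * (rWeight h)⁻¹ := by
    intro h hh
    rw [← Finset.sum_filter, Finset.sum_const, nsmul_eq_mul]
    have hh' := Finset.mem_filter.1 hh
    exact mul_le_mul_of_nonneg_right
      (by exact_mod_cast card_filter_mem_dualLattice_korobovPoint_le hs hN hh'.1 hh'.2)
      (inv_nonneg.2 (rWeight_pos h).le)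
  calc ∑ g ∈ Finset.range N, figureOfMerit (korobovPoint s ((g : ℕ) : ℤ)) N
      = ∑ g ∈ Finset.range N, ∑ h ∈ (centeredBox (Fin s) N).filter (· ≠ 0),
          (if h ∈ dualLattice N (korobovPoint s ((g : ℕ) : ℤ)) then (rWeight h)⁻¹ else 0) :=
        Finset.sum_congr rfl fun g _ => figureOfMerit_eq_sum_ite _ _
    _ = ∑ h ∈ (centeredBox (Fin s) N).filter (· ≠ 0), ∑ g ∈ Finset.range N,
          (if h ∈ dualLattice N (korobovPoint s ((g : ℕ) : ℤ)) then (rWeight h)⁻¹ else 0) := Finset.sum_comm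
    _ ≤ ∑ h ∈ (centeredBox (Fin s) N).filter (· ≠ 0), ((s - 1 : ℕ) : ℝ) * (rWeight h)⁻¹ :=
        Finset.sum_le_sum key
    _ = ((s - 1 : ℕ) : ℝ) * ∑ h ∈ (centeredBox (Fin s) N).filter (· ≠ 0), (rWeight h)⁻¹ := by
        rw [Finset.mul_sum]

/-- **Niederreiter 1992, Theorem 5.18** (existence of good lattice points of Korobov form, averaged
form): for any integer `s ≥ 2` and any prime `N`,
`m_s(N) = (1/N) Σ_{g=0}^{N-1} R((1, g, g², …, g^{s-1}), N) < ((s - 1)/N) (2 log N + 1)^s`.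
[cite: Niederreiter1992, Thm. 5.18] -/
theorem korobovMean_lt {s N : ℕ} (hs : 2 ≤ s) (hN : N.Prime) :
    korobovMean s N < ((s : ℝ) - 1) / N * (2 * Real.log N + 1) ^ s := by
  classical
  have hN1 : 1 ≤ N := hN.one_lt.le
  have hNpos : (0 : ℝ) < N := by exact_mod_cast hN.pos
  have hs1 : 1 ≤ s := le_trans one_le_two hs
  have hs' : (2 : ℝ) ≤ s := by exact_mod_cast hs
  have hL := (harmL_lt N hN.two_le).le
  have hL0 := harmL_nonneg N
  have hcast : ((s - 1 : ℕ) : ℝ) = (s : ℝ) - 1 := by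
    rw [Nat.cast_sub hs1, Nat.cast_one]
  -- dropping the term `𝐡 = 0` is where the inequality becomes strict
  have h0mem : (0 : Fin s → ℤ) ∈ centeredBox (Fin s) N := by
    rw [mem_centeredBox]
    intro j
    rw [mem_centeredResidues, Pi.zero_apply]
    omega
  have hstrict : ∑ h ∈ (centeredBox (Fin s) N).filter (· ≠ 0), (rWeight h)⁻¹
      < (1 + harmL N) ^ s := by
    have e := sum_centeredBox_inv_rWeight_eq (d := Fin s) N hN1
    rw [Fintype.card_fin] at e
    rw [← e, ← Finset.add_sum_erase _ _ h0mem, Finset.filter_ne']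
    have : 0 < (rWeight (0 : Fin s → ℤ))⁻¹ := inv_pos.2 (rWeight_pos _)
    linarith
  unfold korobovMean
  rw [div_eq_mul_inv, mul_comm ((s : ℝ) - 1), mul_assoc]
  refine mul_lt_mul_of_pos_left ?_ (inv_pos.2 hNpos)
  calc ∑ g ∈ Finset.range N, figureOfMerit (korobovPoint s ((g : ℕ) : ℤ)) N
      ≤ ((s - 1 : ℕ) : ℝ) * ∑ h ∈ (centeredBox (Fin s) N).filter (· ≠ 0), (rWeight h)⁻¹ :=
        sum_figureOfMerit_korobovPoint_le hs1 hN
    _ < ((s - 1 : ℕ) : ℝ) * (1 + harmL N) ^ s := by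
        refine mul_lt_mul_of_pos_left hstrict ?_
        rw [hcast]
        linarith
    _ ≤ ((s : ℝ) - 1) * (2 * Real.log N + 1) ^ s := by
        rw [hcast]
        refine mul_le_mul_of_nonneg_left ?_ (by linarith)
        exact pow_le_pow_left₀ (by linarith) (by linarith) s

/-- **Corollary of Theorem 5.18** (Niederreiter 1992, the remark following its proof): for any
dimension `s ≥ 2` and any prime `N` there is a lattice point `g = (1, g, g², …, g^{s-1}) ∈ ℤ^s` of
Korobov form, `0 ≤ g ≤ N - 1`, with `R(g, N) < ((s - 1)/N) (2 log N + 1)^s`.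
[cite: Niederreiter1992, Thm. 5.18] -/
theorem exists_korobovPoint_figureOfMerit_lt {s N : ℕ} (hs : 2 ≤ s) (hN : N.Prime) :
    ∃ g ∈ Finset.range N,
      figureOfMerit (korobovPoint s ((g : ℕ) : ℤ)) N < ((s : ℝ) - 1) / N * (2 * Real.log N + 1) ^ s := by
  have hNpos : (0 : ℝ) < N := by exact_mod_cast hN.pos
  apply Finset.exists_lt_of_sum_lt
  rw [Finset.sum_const, Finset.card_range, nsmul_eq_mul]
  have h := korobovMean_lt hs hN
  unfold korobovMean at h
  rwa [inv_mul_lt_iff₀ hNpos] at h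

end Literature.Analysis.Quadrature

end
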